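import Summits.ResolutionOfSingularities.ResolutionOfSingularities.Theorems.WeightedInvariantWeightedThesisZeroStep
import Summits.ResolutionOfSingularities.ResolutionOfSingularities.Theorems.WeightedInvariantWeightedThesisProjectiveIntegralSuffices
import Summits.ResolutionOfSingularities.ResolutionOfSingularities.Theorems.WeightedInvariantWeightedThesisFiniteBirationalTransfer
import Summits.ResolutionOfSingularities.ResolutionOfSingularities.Theorems.WeightedInvariantWeightedThesisHypersurfaceModelInfinite
import Summits.ResolutionOfSingularities.ResolutionOfSingularities.Theorems.WeightedInvariantWeightedThesisGraphClosure
import Summits.ResolutionOfSingularities.ResolutionOfSingularities.Theorems.WeightedInvariantWeightedThesisImageLocallyPrincipal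
import Summits.ResolutionOfSingularities.ResolutionOfSingularities.Theorems.WeightedInvariantWeightedThesisFiniteFieldBranch
import Summits.ResolutionOfSingularities.ResolutionOfSingularities.Theorems.WeightedInvariantWeightedThesisSeparableProjection
import Literature.AlgebraicGeometry.Resolution.QuasiProjectiveResolution

/-!
# `WeightedInvariant.WeightedThesis`, line `datum-glued-split`: the composition as a theorem —
# `WeightedThesis ⇐ WeightedConstruction ∧ (datum ⇒ resolution of HYPERSURFACES)`

Crux `WeightedThesis` (stmt-ResolutionOfSingularities-0569), lead a1, 2026-08-17 (RESHAPE 4, all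
provable stubs landed). The route's glue `weightedThesis_of_weightedConstruction_of_datumToEmbedded`
(`Theorems/WeightedInvariantWeightedThesisGlueII.lean`) needs item 0572 `DatumToEmbedded` for closed
subschemes of ALL codimensions. This file lands the line's sharper composition
`weightedThesis_of_weightedConstruction_of_datumToHypersurface`: the second input is needed only for
integral closed subschemes WITH LOCALLY PRINCIPAL IDEAL SHEAF (hypersurfaces) of smooth separated
quasi-compact schemes over perfect fields, off the minimal case. Ingredients, all PROVED in the
tree by this line: projective reduction (`ProjectiveIntegralSuffices`, p86611), finite birational
transfer of resolutions (`FiniteBirationalTransfer`, p98340), hypersurface models over infinite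
perfect fields by generic linear projection (`HypersurfaceModelInfinite`, p140615), and over every
perfect field of characteristic `p` up to a proper birational modification
(`FiniteFieldBranch`, p142081, fed by separable projective Noether normalisation
`SeparableProjection` p142892, graph closures `GraphClosure` p141770 and prime divisors on regular
schemes `ImageLocallyPrincipal` p141747), plus the zero step (`ZeroStep`, p87961).
-/

noncomputable section

set_option linter.dupNamespace false -- mandated namespace of this single-conjunct summit

open CategoryTheory CategoryTheory.Limits AlgebraicGeometry
open Literature.AlgebraicGeometry.Resolution
open Summit.ResolutionOfSingularities.ResolutionOfSingularities.Theses.WeightedInvariant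

namespace Summit.ResolutionOfSingularities.ResolutionOfSingularities.Theorems.WeightedThesis.OfHypersurfaceDatum

/-- **`WeightedThesis` from `WeightedConstruction` and the resolution of hypersurfaces by a datum**
(registered glue of line `datum-glued-split`). At a prime `p` and a perfect field `k` of
characteristic `p`, an integral closed `Z ⊆ ℙⁿ_k` has a hypersurface model — `φ : Z → H ⊆ Y` over
infinite `k` (generic linear projection), or `Z ← Z' → H ⊆ ℙ^d ×_k ℙ¹` with `Z' → Z` proper
birational over any perfect `k` of characteristic `p` (separable projection, primitive element,
graph closure), unless `Z` is already regular; the datum resolves the hypersurface `H` (the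
hypothesis off the minimal case, the zero step on it); the resolution is carried back along the
finite birational `φ` and the proper birational `Z' → Z`; projective reduction spreads this to
every reduced separated `k`-scheme of finite type. [folklore] -/
theorem weightedThesis_of_weightedConstruction_of_datumToHypersurface :
    Summit.ResolutionOfSingularities.ResolutionOfSingularities.Theses.WeightedInvariant.WeightedConstruction →
    (∀ (p : ℕ), p.Prime → ∀ (D : Literature.AlgebraicGeometry.Resolution.WeightedResolutionDatum p) (k : Type) [Field k] [CharP k p] [PerfectField k] (Y X : AlgebraicGeometry.Scheme.{0}) (f : Y ⟶ AlgebraicGeometry.Spec (.of k)) (i : X ⟶ Y), AlgebraicGeometry.Smooth f → AlgebraicGeometry.IsSeparated f → AlgebraicGeometry.QuasiCompact f → AlgebraicGeometry.IsClosedImmersion i → AlgebraicGeometry.IsIntegral X → (∀ y : Y, ∃ U : Y.affineOpens, y ∈ (U : Y.Opens) ∧ (i.ker.ideal U).IsPrincipal) → (∃ y : Y, ¬ IsBot (D.inv f i.ker y)) → Literature.AlgebraicGeometry.Resolution.Scheme.HasResolution X) →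
    Summit.ResolutionOfSingularities.ResolutionOfSingularities.Theses.WeightedInvariant.WeightedThesis := by
  intro hW hH p hp k _ _ _ X f hsep hlft hqc hred
  -- a datum resolves integral hypersurfaces: the hypothesis off the minimal case, the zero step on it
  have hyp : ∀ (D : WeightedResolutionDatum p) {Y H : Scheme.{0}} (g : Y ⟶ Spec (.of k))
      [Smooth g] [IsSeparated g] [QuasiCompact g] (j : H ⟶ Y) [IsClosedImmersion j] [IsIntegral H],
      (∀ y : Y, ∃ U : Y.affineOpens, y ∈ (U : Y.Opens) ∧ (j.ker.ideal U).IsPrincipal) →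
      Scheme.HasResolution H := by
    intro D Y H g _ _ _ j _ _ hprinc
    by_cases h : ∀ y : Y, IsBot (D.inv g j.ker y)
    · exact ZeroStep.hasResolution_of_forall_isBot D g j h
    · push Not at h
      exact hH p hp D k Y H g j ‹_› ‹_› ‹_› ‹_› ‹_› hprinc h
  refine ProjectiveIntegralSuffices.stub_projectiveIntegralSuffices k (fun n Z ι hι hint => ?_)
    X f hsep hlft hqc hred
  obtain ⟨D⟩ := hW p hp
  haveI := hint
  rcases finite_or_infinite k with hk | hk
  · rcases HypersurfaceModel.stub_finiteFieldBranch_of_parts HypersurfaceModel.stub_separableProjection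
        HypersurfaceModel.stub_graphClosure HypersurfaceModel.stub_imageLocallyPrincipal
        p hp k n Z ι hι hint with hreg |
        ⟨Z', hZ', ρ, hρ, hbir, Y, H, g, j, φ, hg, hgsep, hgqc, hj, hH', hprinc, hφ, hbirφ⟩
    · exact Scheme.IsRegular.hasResolution hreg
    · haveI := hZ'; haveI := hρ; haveI := hg; haveI := hgsep; haveI := hgqc; haveI := hj; haveI := hH'
      exact Scheme.HasResolution.of_isBirational ρ hbir
        (FiniteBirationalTransfer.stub_finiteBirationalTransfer Z' H φ hφ hbirφ (hyp D g j hprinc))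
  · obtain ⟨Y, H, g, j, φ, hg, hgsep, hgqc, hj, hH', hprinc, hφ, hbir⟩ :=
      HypersurfaceModel.stub_hypersurfaceModel_infinite k n Z ι hι hint
    haveI := hg; haveI := hgsep; haveI := hgqc; haveI := hj; haveI := hH'
    exact FiniteBirationalTransfer.stub_finiteBirationalTransfer Z H φ hφ hbir (hyp D g j hprinc)

end Summit.ResolutionOfSingularities.ResolutionOfSingularities.Theorems.WeightedThesis.OfHypersurfaceDatum

end
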